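import Mathlib
import HarnessLib
import Summits.HubbardSuperconductivity.HubbardSuperconductivity.Theorems.ComplexGFFStiffnessHypACumulantTunedRepresentation
import Literature.MathematicalPhysics.StatisticalMechanics.TunedFlowLastScale

/-!
# Crux `HypALocalTwoPoint`, line `gnv` — the TUNED SYSTEM of the free-energy assembly, II:
# the last-scale integral along a tuned trajectory, `I(𝒦, x₀) = 1 + Φ(x₀, y_N)`

Route `route-HubbardSuperconductivity-ComplexGFFStiffness`, crux item stmt-HubbardSuperconductivity-19155,
registered stub `stub_twoPointGivenZ`, census F1 (assembly of `FreeEnergyBounds`), part (iii-a) continued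
(`…HypALocalTwoPointTunedSystem`).  Along a tuned trajectory `x` of the concrete system
`(rgA, rgBT, rgSQ, initAct 𝒦 x₀)` at the kernels `𝒞_{𝟙+q(x₀)}`:

* `integral_flowStart_eq_one_add_lastScaleInt` — the integral
  `I = ∫ (e^{−ℋ} ∘_0 K̂_0(𝒦,ℋ))(Λ) d(tailMeasure 𝒞_{𝟙+q(ℋ)} N N)` of the representation
  `pertZ = Z₀ exp(log κ + |Λ|λ(ℋ) + Log I)` (`…FreeEnergyRepresentation`) equals `1 + Φ(x₀, y_N)` with
  `Φ(x₀, y) = ∫ y(Λ) dμ_{N+1}^{(q(x₀))}` the last-scale functional and `y_N` the final activity, and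
  `‖I − 1‖ ≤ εη^N A⁻¹A_𝒫` (`TunedFlowLastScale`, `TunedFlowRepresentation` under the [ABKM19] package).

All proved, no `sorry`.

## References
* S. Adams, S. Buchholz, R. Kotecký, S. Müller, arXiv:1910.13564, Ch. 4.2–4.4 (4.11)–(4.12), Ch. 12,
  Lemma 12.6 [AdamsBuchholzKoteckyMuller2019].
-/


noncomputable section

-- `Summit.<Summit>.<Problem>`: single-conjunct summit, the duplicate component is mandated (D-0017).
set_option linter.dupNamespace false

namespace Summit.HubbardSuperconductivity.HubbardSuperconductivity.Theorems.ComplexGFF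

open scoped BigOperators ComplexConjugate
open Real Set Finset MeasureTheory
open Literature.MathematicalPhysics.StatisticalMechanics.GradientRG
open Literature.MathematicalPhysics.StatisticalMechanics.GradientFRD
  (fourierCoeff cExt cExt_of_mem IsElliptic IsUnitSymm InShell iterDiff supNorm conv ellOp isElliptic_one)
open Literature.MathematicalPhysics.StatisticalMechanics.TorusPolymer
  (IsPolymer numBlocks blockOf boxCorner isPolymer_blockOf isConn_blockOf pcirc)
open Literature.Barriers.CriticalPhenomena.LongRangePhi4.Polymer (IsConn components)
open Literature.MathematicalPhysics.QuantumFieldTheory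
open Literature.Dynamics.Hyperbolic

variable {d M : ℕ} [NeZero M]

section Package

variable {L N Mord R n ñ : ℕ} {θbar lam μ δ₁ δ₀ A𝒫 : ℝ}
    {𝒞 : Matrix (Fin d) (Fin d) ℝ → ℕ → (Fin d → ZMod M) → ℝ} {Mc : ℕ → ℝ}
    {Cα : (Fin d → ℕ) → ℕ → ℝ} {c C : ℝ} {Cℓ : ℕ → ℝ}

set_option maxHeartbeats 1600000 in
/-- **The last-scale integral along a tuned trajectory of system `(𝒦, x₀)`**: under the package, for a
seed `x₀` with `‖x₀‖ ≤ ρ` carrying a tuned trajectory `x` of `(rgA, rgBT, rgSQ, initAct 𝒦 x₀)` at the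
kernels `𝒞_{𝟙+q(x₀)}` in the `ε`-tube with `x 0 = x₀`, the integral
`I = ∫ (e^{−ℋ} ∘_0 K̂_0(𝒦,ℋ))(Λ) d(tailMeasure 𝒞_{𝟙+q(ℋ)} N N)` (`ℋ = toHam x₀`) of the free-energy
representation equals `1 + Φ(x₀, y_N)`, `Φ(x₀, y) = ∫ y(Λ) dμ_{N+1}^{(q(x₀))}`, `y_N` the final activity,
and `‖I − 1‖ ≤ εη^N A⁻¹A_𝒫` (`TunedFlowLastScale`, `TunedFlowRepresentation`). ([ABKM19] (4.11)–(4.12).) -/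
theorem integral_flowStart_eq_one_add_lastScaleInt {h : ℝ} [Fact (0 < h)] [Fact (0 < L)]
    (hd : 3 ≤ d) (hMord : 1 ≤ Mord) (hMR : Mord ≤ R) (hLodd : Odd L) (hL : 2 ^ (d + 3) + 16 * R ≤ L)
    (hR2 : 2 ≤ R) (hM : M = L ^ N)
    (hθbar : 0 < θbar) (hlam : 0 < lam) (hn : 2 * Mord ≤ n) (hn2 : 2 ≤ n) (hnñ : n ≤ ñ)
    (hc : 0 < c) (hC1 : 0 ≤ Cℓ 1)
    (hallA : ∀ A : Matrix (Fin d) (Fin d) ℝ, IsElliptic (1 / 2 : ℝ) 2 A →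
        (∀ k, 1 ≤ k → k ≤ N + 1 →
          ∑ x : Fin d → ZMod M, 𝒞 A k x = 0 ∧ ∀ x, 𝒞 A k (-x) = 𝒞 A k x) ∧
        (∀ k, 1 ≤ k → k ≤ N + 1 → ∀ φ : (Fin d → ZMod M) → ℝ, ∑ x, φ x = 0 →
          0 ≤ ∑ x, ∑ y, φ x * 𝒞 A k (x - y) * φ y) ∧
        (∀ φ : (Fin d → ZMod M) → ℝ, ∑ x, φ x = 0 →
          ellOp A (conv (fun x => ∑ k ∈ Finset.Icc 1 (N + 1), 𝒞 A k x) φ) = φ) ∧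
        (∀ k, 1 ≤ k → k ≤ N → Mc k ≤ 0 ∧
          ∀ x : Fin d → ZMod M, ((L : ℝ) ^ k) / 2 ≤ (supNorm x : ℝ) →
            𝒞 A k x = Mc k) ∧
        (∀ k, 1 ≤ k → k ≤ N + 1 → ∀ B : Matrix (Fin d) (Fin d) ℝ, IsUnitSymm B →
          (∃ ε : ℝ, 0 < ε ∧ ∀ x : Fin d → ZMod M,
            ContDiffOn ℝ ⊤ (fun s : ℝ => 𝒞 (A + s • B) k x) (Set.Ioo (-ε) ε)) ∧
          ∀ α : Fin d → ℕ, ∑ i, α i ≤ n → ∀ ℓ : ℕ, ∀ x : Fin d → ZMod M,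
            abs (iteratedDeriv ℓ (fun s : ℝ => iterDiff α (𝒞 (A + s • B) k) x) 0)
              ≤ Cα α ℓ / (L : ℝ) ^ ((k - 1) * (d - 2 + ∑ i, α i))) ∧
        (∀ k, 1 ≤ k → k ≤ N + 1 → ∀ j : ℕ, ∀ κ : Fin d → ZMod M, κ ≠ 0 → InShell L j κ →
          (j < k →
            c / (L : ℝ) ^ (2 * (d + ñ) + 1) * (L : ℝ) ^ (2 * j)
                / (L : ℝ) ^ ((k - j) * (d - 1 + n)) ≤ (fourierCoeff (𝒞 A k) κ).re ∧
            ‖fourierCoeff (𝒞 A k) κ‖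
              ≤ C * (L : ℝ) ^ (2 * (d + ñ) + 1) * (L : ℝ) ^ (2 * j)
                  / (L : ℝ) ^ ((k - j) * (d - 1 + n))) ∧
          (k ≤ j →
            c / (L : ℝ) ^ (2 * (d + ñ) + 1) * (L : ℝ) ^ (2 * k)
                ≤ (fourierCoeff (𝒞 A k) κ).re ∧
            ‖fourierCoeff (𝒞 A k) κ‖ ≤ C * (L : ℝ) ^ (2 * k)) ∧
          ∀ B : Matrix (Fin d) (Fin d) ℝ, IsUnitSymm B → ∀ ℓ : ℕ, 1 ≤ ℓ →
            (j < k →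
              ‖iteratedDeriv ℓ (fun s : ℝ => fourierCoeff (𝒞 (A + s • B) k) κ) 0‖
                ≤ Cℓ ℓ * (L : ℝ) ^ (2 * (d + ñ) + 1) * (L : ℝ) ^ (2 * j)
                    / (L : ℝ) ^ ((k - j) * (d - 1 + ñ))) ∧
            (k ≤ j →
              ‖iteratedDeriv ℓ (fun s : ℝ => fourierCoeff (𝒞 (A + s • B) k) κ) 0‖
                ≤ Cℓ ℓ * (L : ℝ) ^ (2 * k))))
    (hB : AbkmWeightBounds L N Mord R n θbar lam μ δ₁ δ₀ A𝒫 (fun j => 𝒞 1 j)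
      (abkmWeightData L N Mord R θbar (schedDelta δ₀ δ₁ N) fun j => 𝒞 1 j))
    {pT r₀ : ℕ} (hp : d / 2 + 2 ≤ pT) (hpM : pT + d ≤ Mord) (hr₀ : 3 ≤ r₀)
    (hδ₀ : 0 < δ₀) (hδ₁ : 0 < δ₁) (hh0 : hZeroSq d R δ₀ δ₁ ≤ h ^ 2)
    (hh2 : secondDiffConst (fun θ' => Cα θ' 0) ≤ h ^ 2)
    -- the tuning ball
    {θ : ℝ} (hθ0 : 0 ≤ θ) (hθ : θ < θbar)
    {T₀ : ℝ} (hT₀ : T₀ ≤ 1 / 2) (hKT₀ : shellRatioConst c (Cℓ 1) (L : ℝ) d ñ * T₀ ≤ Real.log (1 + θ))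
    {A𝒫' : ℝ} (hA𝒫' : weightIntConstRho θbar θ (traceConst d Mord R lam (derivSum d n fun θ' _ => Cα θ' 0)) = A𝒫')
    -- the side conditions of Theorem 6.8 (`RGStepABKMQ`), at `A_𝒫' = A_𝒫(θ)`
    {A : ℝ} (hA1 : 1 ≤ A) (hA𝒫A : A𝒫' ≤ A)
    (hsmall : (2 : ℝ) ^ (L ^ d) * (A𝒫' * A ^ (-(1 - (1 + 1 / ((2 * (2 ^ d + 1) + 6 : ℝ) ^ d))⁻¹) : ℝ)) ≤ 1)
    {r : ℝ} (hr : r ≤ 1 / 64)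
    (hv : vABKM d R A A𝒫' r ≤ 1 / 64) (hωA : omegaABKM d R A A𝒫' r * A ^ 2 ≤ 1)
    (hc3A : (kappaABKM d R A A𝒫' r) ^ (L ^ d) * ((2 * (2 * (kappaABKM d R A A𝒫' r) * max 1 A𝒫')) ^ ((2 ^ (d + 1) + 2) ^ d * L ^ d) * (4 : ℝ) ^ ((2 ^ (d + 1) + 2) ^ d * L ^ d)) ≤ A ^ ((1 + 1 / ((2 * (2 ^ d + 1) + 6 : ℝ) ^ d)) - 1 : ℝ))
    (hc2A : (kappaABKM d R A A𝒫' r) ^ (L ^ d) * ((2 * (kappaABKM d R A A𝒫' r) * max 1 A𝒫') ^ ((2 ^ (d + 1) + 2) ^ d * L ^ d) * (2 : ℝ) ^ ((2 ^ (d + 1) + 2) ^ d * L ^ d)) ≤ A ^ ((1 + 1 / ((2 * (2 ^ d + 1) + 6 : ℝ) ^ d)) - 1 : ℝ))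
    {η ε ρ : ℝ} (hη : 0 < η) (hη1 : η ≤ 1) (hε : 0 ≤ ε) (hεr : ε ≤ r) (hερ : ε ≤ ρ) (hρ16 : ρ ≤ 1 / 16)
    -- the initial perturbation
    {𝒦 : (Fin d → ℝ) → ℂ} {ρ𝒦 : ℝ} (h𝒦 : ContDiff ℝ r₀ 𝒦)
    (h𝒦b : ∀ s, s ≤ r₀ → ∀ z : Fin d → ℝ, ‖iteratedFDeriv ℝ s 𝒦 z‖ ≤ ρ𝒦 * Real.exp ((∑ i, z i ^ 2) / 4))
    (h𝒦small : (Real.exp (1 / 4) + 2 * Real.exp (3 / 8)) *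
      (ρ𝒦 * Real.exp (fieldWt h (L : ℝ) d 0 / (L : ℝ) ^ 0)) * A ≤ 1 / 2)
    
    
    (hp4 : 4 * pT ≤ 2 ^ (d + 2))
    (hqT₀ : 2 * (d : ℝ) ^ 2 / (((L ^ (d * 0) : ℕ) : ℝ) * (fieldWt h (L : ℝ) d 0 / (L : ℝ) ^ 0) ^ 2) * ρ ≤ T₀)
    {x₀ : HamSpace ℂ d (fieldWt h (L : ℝ) d 0) ((L : ℝ) ^ 0) (L ^ (d * 0))} (hx₀ρ : ‖x₀‖ ≤ ρ)
    {x : ∀ k, HamSpace ℂ d (fieldWt h (L : ℝ) d k) ((L : ℝ) ^ k) (L ^ (d * k))}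
    (htraj : RGFlow.IsTunedQ (E := (fun k => HamSpace ℂ d (fieldWt h (L : ℝ) d k) ((L : ℝ) ^ k) (L ^ (d * k)))) (F := (fun k => activitySpace (abkmNormParams L N Mord R pT r₀ h θbar A (schedDelta δ₀ δ₁ N) fun j => 𝒞 1 j) k)) N
      (rgA L h (fun j => 𝒞 ((1 : Matrix (Fin d) (Fin d) ℝ) + hamTuningMap ρ x₀) j))
      (rgBT hd hMord hMR hLodd hL hM hθbar hlam hn hn2 hnñ hc hC1 hallA hB pT r₀ hr₀ A hθ0 hθ hT₀ hKT₀ (hamTuningMap ρ x₀))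
      (rgSQ (L := L) (N := N) (Mord := Mord) (R := R) (p := pT) (r₀ := r₀) (h := h) (θbar := θbar) (A := A)
              (δ₀ := δ₀) (δ₁ := δ₁) (𝒞 := fun j => 𝒞 1 j) (fun j => 𝒞 ((1 : Matrix (Fin d) (Fin d) ℝ) + hamTuningMap ρ x₀) j))
      (initAct (N := N) (Mord := Mord) (R := R) (p := pT) (r₀ := r₀) (θbar := θbar) (A := A) (δ₀ := δ₀)
              (δ₁ := δ₁) (𝒞 := fun j => 𝒞 1 j) 𝒦 x₀) x)
    (htube : RGFlow.InTubeQ (E := (fun k => HamSpace ℂ d (fieldWt h (L : ℝ) d k) ((L : ℝ) ^ k) (L ^ (d * k)))) (F := (fun k => activitySpace (abkmNormParams L N Mord R pT r₀ h θbar A (schedDelta δ₀ δ₁ N) fun j => 𝒞 1 j) k)) N η ε (activityNormLE (abkmNormParams L N Mord R pT r₀ h θbar A (schedDelta δ₀ δ₁ N) fun j => 𝒞 1 j))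
      (rgSQ (L := L) (N := N) (Mord := Mord) (R := R) (p := pT) (r₀ := r₀) (h := h) (θbar := θbar) (A := A)
              (δ₀ := δ₀) (δ₁ := δ₁) (𝒞 := fun j => 𝒞 1 j) (fun j => 𝒞 ((1 : Matrix (Fin d) (Fin d) ℝ) + hamTuningMap ρ x₀) j))
      (initAct (N := N) (Mord := Mord) (R := R) (p := pT) (r₀ := r₀) (θbar := θbar) (A := A) (δ₀ := δ₀)
              (δ₁ := δ₁) (𝒞 := fun j => 𝒞 1 j) 𝒦 x₀) x)
    (hx0 : x 0 = x₀) :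
    (∫ φ, pcirc 1 (fun V => expNegH (HamSpace.toHam x₀) V φ)
            (fun U => initKH 𝒦 (HamSpace.toHam x₀) U φ) Finset.univ
          ∂(tailMeasure (fun j => 𝒞 ((1 : Matrix (Fin d) (Fin d) ℝ) + hamQuadForm (HamSpace.toHam x₀)) j) N N))
        = 1 + (∫ φ, ((RGFlow.fwd (rgSQ (L := L) (N := N) (Mord := Mord) (R := R) (p := pT) (r₀ := r₀) (h := h) (θbar := θbar) (A := A)
              (δ₀ := δ₀) (δ₁ := δ₁) (𝒞 := fun j => 𝒞 1 j) (fun j => 𝒞 ((1 : Matrix (Fin d) (Fin d) ℝ) + hamTuningMap ρ x₀) j)) (initAct (N := N) (Mord := Mord) (R := R) (p := pT) (r₀ := r₀) (θbar := θbar) (A := A) (δ₀ := δ₀)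
              (δ₁ := δ₁) (𝒞 := fun j => 𝒞 1 j) 𝒦 x₀) x N : activitySpace (abkmNormParams L N Mord R pT r₀ h θbar A (schedDelta δ₀ δ₁ N) fun j => 𝒞 1 j) N) : Finset (Fin d → ZMod M) → ((Fin d → ZMod M) → ℝ) → ℂ) Finset.univ φ
          ∂(stepMeasure (𝒞 ((1 : Matrix (Fin d) (Fin d) ℝ) + hamTuningMap ρ x₀) (N + 1)))) ∧
      ‖(∫ φ, pcirc 1 (fun V => expNegH (HamSpace.toHam x₀) V φ)
            (fun U => initKH 𝒦 (HamSpace.toHam x₀) U φ) Finset.univ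
          ∂(tailMeasure (fun j => 𝒞 ((1 : Matrix (Fin d) (Fin d) ℝ) + hamQuadForm (HamSpace.toHam x₀)) j) N N)) - 1‖ ≤ ε * η ^ N * A⁻¹ * A𝒫' := by
  have hh : 0 < h := Fact.out
  have hd2 : 2 ≤ d := by omega
  have hA : 0 < A := by linarith
  have hρ0 : 0 ≤ ρ := hε.trans hερ
  have hA𝒫0 : 0 ≤ A𝒫' := by
    rw [← hA𝒫']
    exact zero_le_one.trans (one_le_weightIntConstRho hθbar hθ0 hθ
      (traceConst_nonneg d Mord R hlam.le (derivSum_nonneg d n _)))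
  have hq0 : hamTuningMap ρ x₀ = hamQuadForm (HamSpace.toHam x₀) := hamTuningMap_of_le hx₀ρ
  have hqsymm : (hamTuningMap ρ x₀).IsSymm := hamTuningMap_isSymm ρ x₀
  have hqT : ∑ i, ∑ j, |hamTuningMap ρ x₀ i j| ≤ T₀ := (entrySum_hamTuningMap_le hρ0 x₀).trans hqT₀
  -- the tuned kernel family and its properties
  set 𝒞s : ℕ → (Fin d → ZMod M) → ℝ := fun j => 𝒞 ((1 : Matrix (Fin d) (Fin d) ℝ) + hamTuningMap ρ x₀) j with h𝒞s
  have hell : IsElliptic (1 / 2 : ℝ) 2 ((1 : Matrix (Fin d) (Fin d) ℝ) + hamTuningMap ρ x₀) :=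
    isElliptic_one_add_of_entrySum_le hqsymm (hqT.trans hT₀)
  obtain ⟨hA0, -, -, hAiii, -⟩ := hallA _ hell
  have hS : ∀ k, k ≤ N → StepKernelBounds (abkmWeightData L N Mord R θbar (schedDelta δ₀ δ₁ N) fun j => 𝒞 1 j) L k
      A𝒫' (secondDiffConst fun θ' => Cα θ' 0) (𝒞s (k + 1)) := by
    intro k hk
    have h := stepKernelBounds_one_add_of_torusFRD hd hMord hMR hLodd hL hθbar hlam hn hn2 hnñ hc hC1 hallA hB
      (k := k) (by omega) hθ0 hθ hT₀ hKT₀ hqsymm hqT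
    rw [hA𝒫'] at h
    exact h
  have h0s : ∀ k, k + 1 ≤ N → ∑ z, 𝒞s (k + 1) z = 0 ∧ ∀ z, 𝒞s (k + 1) (-z) = 𝒞s (k + 1) z :=
    fun k hk => hA0 (k + 1) (by omega) (by omega)
  have hranges : ∀ k, k + 1 ≤ N → ∃ m : ℝ, m ≤ 0 ∧
      ∀ z : Fin d → ZMod M, ((L : ℝ) ^ (k + 1)) / 2 ≤ (supNorm z : ℝ) → 𝒞s (k + 1) z = m := by
    intro k hk
    obtain ⟨hMc, hfr⟩ := hAiii (k + 1) (by omega) hk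
    exact ⟨Mc (k + 1), hMc, hfr⟩
  -- the initial activity is admissible
  have hH8 : hamNorm (fieldWt h (L : ℝ) d 0) ((L : ℝ) ^ 0) (L ^ (d * 0)) (HamSpace.toHam x₀) ≤ 1 / 8 := by
    rw [← HamSpace.norm_def]; linarith
  have hsm1 : Real.exp (1 / 4) * (ρ𝒦 * Real.exp (fieldWt h (L : ℝ) d 0 / (L : ℝ) ^ 0)) * A ≤ 1 := by
    have h2 : Real.exp (1 / 4) ≤ Real.exp (1 / 4) + 2 * Real.exp (3 / 8) := by
      have := Real.exp_pos (3 / 8 : ℝ); linarith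
    have hρ𝒦 : 0 ≤ ρ𝒦 := by
      have h0 := (norm_nonneg _).trans (h𝒦b 0 (Nat.zero_le _) 0)
      exact (mul_nonneg_iff_of_pos_right (Real.exp_pos _)).1 h0
    have h3 : Real.exp (1 / 4) * (ρ𝒦 * Real.exp (fieldWt h (L : ℝ) d 0 / (L : ℝ) ^ 0)) * A ≤
        (Real.exp (1 / 4) + 2 * Real.exp (3 / 8)) * (ρ𝒦 * Real.exp (fieldWt h (L : ℝ) d 0 / (L : ℝ) ^ 0)) * A :=
      mul_le_mul_of_nonneg_right (mul_le_mul_of_nonneg_right h2 (mul_nonneg hρ𝒦 (Real.exp_pos _).le)) hA.le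
    exact h3.trans (h𝒦small.trans (by norm_num))
  have hmem₀ := restrictConn_initKH_mem_activitySpace (N := N) (R := R) (n := n) (p := pT) (r₀ := r₀) (θbar := θbar)
    (lam := lam) (μ := μ) (δ₁ := δ₁) (δ₀ := δ₀) (A𝒫 := A𝒫) hd2 hLodd hM (by omega) (by omega) hB hδ₀ hδ₁ hh hh0 hA
    h𝒦 h𝒦b hH8 hsm1
  -- `B_k` acts as `opB`
  have hBeq : ∀ k, k < N → ∀ y : activitySpace (abkmNormParams L N Mord R pT r₀ h θbar A (schedDelta δ₀ δ₁ N)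
      fun j => 𝒞 1 j) k,
      HamSpace.toHam (rgBT hd hMord hMR hLodd hL hM hθbar hlam hn hn2 hnñ hc hC1 hallA hB pT r₀ hr₀ A hθ0 hθ hT₀ hKT₀
        (hamTuningMap ρ x₀) k y) =
        opB (abkmStepData L R k 𝒞s) (y : Finset (Fin d → ZMod M) → ((Fin d → ZMod M) → ℝ) → ℂ) := by
    intro k hk y
    rw [rgBT_of_mem hd hMord hMR hLodd hL hM hθbar hlam hn hn2 hnñ hc hC1 hallA hB pT r₀ hr₀ A hθ0 hθ hT₀ hKT₀
      hqsymm hqT]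
    unfold rgBQ
    rw [dif_pos (by omega : k + 1 ≤ N)]
    simp only [AddMonoidHom.coe_comp, Function.comp_apply, LinearMap.toAddMonoidHom_coe,
      LinearEquiv.coe_toLinearMap, HamSpace.toHam_ofHam, opBHomQ_apply]
    rfl
  have hid := integral_flowStart_eq_one_add_integral_last_of_isTunedQ (p := pT) (r₀ := r₀) hd hLodd hL hR2 hM hp hp4
    hpM hMR hr₀ hB hδ₀ hδ₁ hh0 hS h0s hranges hh2 hA𝒫0 hA1 hA𝒫A hsmall hr hv hωA hc3A hc2A hη hη1 hε hεr hmem₀ hBeq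
    htraj htube hx0
  have hbd := norm_integral_flowStart_sub_one_le_of_isTunedQ (p := pT) (r₀ := r₀) hd hLodd hL hR2 hM hp hp4 hpM hMR hr₀
    hB hδ₀ hδ₁ hh0 hS h0s hranges hh2 hA𝒫0 hA1 hA𝒫A hsmall hr hv hωA hc3A hc2A hη hη1 hε hεr hmem₀ hBeq htraj htube hx0
  rw [← hq0]
  exact ⟨hid, hbd⟩

end Package

end Summit.HubbardSuperconductivity.HubbardSuperconductivity.Theorems.ComplexGFF

end
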